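import Summits.ValiantsHypothesis.ValiantsHypothesis.Theorems.BarrierLeverAnchoredDoorHitsLowerPairsEvalDoor

/-!
# Support item `AnchoredDoorHitsLowerPairs` (stmt-ValiantsHypothesis-22510), line `anchored-peeling`:
# THE BINARY ONE-LINE DOOR — Conjecture B with the matrix `α_{ad} = γ_d^{2^a}`: ONE parameter per column vertex

Helper file (`--supports stmt-ValiantsHypothesis-22510`; cell valiant-natproofs, rung V4; prover seat val-np-p1 gen 28; memo
HOME/val-np-p1/g28/MEMO-evaldoor-valnp1-g28.md §11). Closes NO item.

WHAT. `Stmt.conjBiEval` (p712689) asks for an `h × h` matrix `α`. Numerically the BINARY specialisation `α_{ad} = γ_d^{2^a}` already works on every lower pair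
tested (all 2 112 pairs with ≤ 5+5 vertices in every orientation, the named census pairs, random pairs incl. the wide ones that kill the plain Vandermonde
`γ_d^{a+1}` through the twisted-cubic degeneracy — with exponents `2^a` the row monomials `x^U` restrict to DISTINCT powers `γ^{bin U}`). Its layout entry is
the positive configuration sum `M(U, W) = Σ ∏_i γ_{min W_i}^{bin U_i} (∏_{e ∈ W_i ∖ min W_i} γ_e)^{2^{min U_i}}` over equinumerous set partitions `U = ⊔ U_i`,
`W = ⊔ W_i` and block bijections (memo §11), so U1 becomes a family of polynomial identities in `h` variables with 0/1-generated entries.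
* `exp2Matrix γ` — the matrix; `Stmt.conjExp2Door` — the node (offered text); `conjBiEval_of_conjExp2Door` — it implies Conjecture B, hence
  `stub_vertexStep` and the item by name (`stub_vertexStep_of_conjExp2Door`, `anchoredDoorHitsLowerPairs_of_conjExp2Door`).

WHAT THIS IS NOT: not proved; no pair certified; nothing on crux stmt-ValiantsHypothesis-14610 or on `VP` versus `VNP`.
-/

set_option linter.dupNamespace false

namespace Summit.ValiantsHypothesis.ValiantsHypothesis.Theorems.BarrierLever.AnchoredPeeling

noncomputable section

variable {h : ℕ}

/-- **The binary one-line matrix:** `α_{ad} = γ_d^{2^a}` (row vertex `a`, column vertex `d`). -/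
def exp2Matrix (γ : Fin h → ℂ) : Fin h → Fin h → ℂ := fun a d => γ d ^ (2 ^ (a : ℕ))

/-- **CONJECTURE B₂ — THE BINARY ONE-LINE DOOR (offered node text).** For all `h`, `r` and every injective pair `u`, `w` of enumerations of lower
families, SOME `γ : Fin h → ℂ` makes the profile-1 symbolic minor nonzero at the bi-evaluation point of the matrix `α_{ad} = γ_d^{2^a}` (anchor `(a|d)`:
weight `γ_d^{2^a}`, `x`-tails `γ_d^{2^b}` at `b > a`, `y`-tails `γ_e^{2^a}` at `e > d`). WHY IT MIGHT FAIL: a lower pair on which this `h`-parameter door is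
identically singular (none among ≈ 2 700 pairs incl. every pair with ≤ 5+5 vertices; the Vandermonde variant `γ_d^{a+1}` DOES fail, e.g. on
(triangle graph, six points), where the row space restricted to the twisted cubic collapses). -/
def Stmt.conjExp2Door : Prop :=
  ∀ (h r : ℕ) (u w : Fin r → Finset (Fin h)), Function.Injective u → Function.Injective w →
    IsLowerSet (Set.range u) → IsLowerSet (Set.range w) →
    ∃ γ : Fin h → ℂ, MvPolynomial.eval (biEvalPoint (exp2Matrix γ)) (symbolicDet 1 h r u w) ≠ 0

/-- **B₂ ⟹ B.** -/
theorem conjBiEval_of_conjExp2Door (hB : Stmt.conjExp2Door) : Stmt.conjBiEval := by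
  intro h r u w hu hw hlu hlw
  obtain ⟨γ, hγ⟩ := hB h r u w hu hw hlu hlw
  exact ⟨exp2Matrix γ, hγ⟩

/-- **B₂ ⟹ the registered stub `stub_vertexStep`.** -/
theorem stub_vertexStep_of_conjExp2Door (hB : Stmt.conjExp2Door) : Stmt.stub_vertexStep :=
  stub_vertexStep_of_conjBiEval (conjBiEval_of_conjExp2Door hB)

/-- **Composition BY NAME: `Stmt.conjExp2Door → AnchoredDoorHitsLowerPairs`.** -/
theorem anchoredDoorHitsLowerPairs_of_conjExp2Door (hB : Stmt.conjExp2Door) :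
    Summit.ValiantsHypothesis.ValiantsHypothesis.Theses.BarrierLever.AnchoredDoorHitsLowerPairs :=
  anchoredDoorHitsLowerPairs_of_conjBiEval (conjBiEval_of_conjExp2Door hB)

end

end Summit.ValiantsHypothesis.ValiantsHypothesis.Theorems.BarrierLever.AnchoredPeeling
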